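import Summits.BirchSwinnertonDyer.BirchSwinnertonDyer.Theorems.EisensteinPrimesTwistDeformationLocalConditions
import Literature.NumberTheory.IwasawaTheory.IwasawaAlgebraTwoVar
import Literature.NumberTheory.IwasawaTheory.Greenberg2016.GlobalToLocalSurjectivityProofs
import Literature.NumberTheory.IwasawaTheory.Greenberg2006.CoinducedModuleDual
import HarnessLib

/-!
# Route `EisensteinPrimes` (rung K5), crux 2 `GoodLatticeBDPValue`, line `halves` v16, stub
# `stub_imprimCorank`, road (A): the ONE-variable anticyclotomic twist deformation
# `𝐃₁ = A ⊗ Λ^*(Ψ⁻¹)` (`bigRep`) is COFREE OF CORANK ONE and `Λ`-DIVISIBLE over `Λ = ℤ_p⟦T⟧`, and the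
# standing clauses of Greenberg's arena for `R = Λ = ℤ_p⟦T⟧` (helper for stmt-BirchSwinnertonDyer-19032)

Cell `bsd-eis`, seat `bsd-line-x1-p1` LEAD g2 (D-0154 row 4). ROAD (A) of the LEAD verdict v3.1 §3 for
the last PUB-composed stub of the line `halves` (`stub_imprimCorank =
KellerYin2024.prop125_residualPair_unrSelmer_corank_ge`, the `≥` half of the character `S`-relaxation
corank identity): derive it from Greenberg 2016 Prop. 2.6.3 (`Greenberg2016.prop263_sur_of_crk`, the
SURJECTIVITY of the global-to-local map) applied to the ONE-variable twist deformation
`𝐃₁ = bigRep κ ρ₀` of a character over the anticyclotomic `ℤ_p`-tower (the tree's co-induced model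
`Literature.NumberTheory.EllipticCurves.AnticyclotomicBigGaloisRep`), exactly as the cell's road (γ)
applied Prop. 4.1.1 to the TWO-variable `twistDeformation`. THIS FILE is the one-variable twin of
`EisensteinPrimesTwistDeformationCofree` (§3–§4 there):

* §1 the standing clauses of the arena for `R = Λ = ℤ_p⟦T⟧` (`m = 1`): `Λ ≃+* MvPowerSeries (Fin 1) ℤ_p`,
  `IsAdicComplete 𝔪 Λ`, residue field `𝔽_p` (finite, characteristic `p`);
* §2 the ONE-variable MOMENT PAIRING `Λ → Hom(𝐃₁, C)`, `F ↦ (Φ ↦ j((F • Φ)(0)))`, a bijection as soon as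
  `ℤ_p ≅ Hom(A, C)` through `j` (the terminating Mahler expansion `eq_sum_binom` of the engine file
  `EisensteinPrimesTwistDeformationMahler`), whence EVERY balanced `C`-dual of `𝐃₁ = BigRepModule ℤ_[p] p A`
  is `≃ₗ Λ` (`nonempty_linearEquiv_of_isDualPairing`): `IsCofree`, `HasCorank … 1`,
  `IsCofinitelyGenerated`, `RFX`;
* §3 `𝐃₁` is `Λ`-DIVISIBLE (`Greenberg2016.IsDivisible`, the hypothesis "`𝐃` is divisible as a
  `Λ`-module" of Prop. 2.6.3): a character killing `θ𝐃₁` is `θ`-torsion in the dual `≃ₗ Λ`, a domain.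

Elementary and unconditional; THEOREMS ONLY (the pairing is produced as `∃ μ`, no `def`); no named
fact, no `sorry`. HONEST FRAMING: closes
nothing by itself (`--supports`). References: [Greenberg2006] p. 342 L5–11 ("`𝒟 = 𝒯 ⊗_Λ Λ̂`, which is
a cofree `Λ`-module"); [Greenberg2016Selmer] §1 p. 4 L5–13 (the arena), §2.5 p. 8 (divisible), §4.3
p. 20 L19–23; [Greenberg2010] Prop. 3.2.1 p. 15 ("Suppose that `D` is divisible as a `Λ`-module");
[SkinnerUrban2014] Prop. 3.2.3 (`Λ^* = lim Maps(Γ/Γ^{pⁿ}, ·)`).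
-/

set_option autoImplicit false
set_option linter.dupNamespace false

noncomputable section

open scoped Classical
open Finset PowerSeries IsLocalRing
open Literature.NumberTheory.EllipticCurves Literature.NumberTheory.IwasawaTheory
  Literature.NumberTheory.IwasawaTheory.Greenberg2016 Literature.NumberTheory.IwasawaTheory.Greenberg2006
  Summit.BirchSwinnertonDyer.BirchSwinnertonDyer.Theorems.TwistDeformationCofree

namespace Summit.BirchSwinnertonDyer.BirchSwinnertonDyer.Theorems.AcTwistDeformation

/-! ## §1 The standing clauses of the arena for `R = Λ = ℤ_p⟦T⟧` (`m = 1`) -/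

section Arena

variable (p : ℕ) [Fact p.Prime]

/-- The clause `Nonempty (Λ ≃+* MvPowerSeries (Fin m) ℤ_[p])` for `Λ = ℤ_p⟦T⟧`, `m = 1`: a power series
ring in one variable is the multivariate one on `Fin 1` (Mathlib `MvPowerSeries.renameEquiv` along
`Unit ≃ Fin 1`). [cite: Greenberg2016Selmer, §1 p. 4 L11–13] -/
theorem nonempty_iwasawaAlgebra_ringEquiv_mvPowerSeries :
    Nonempty (PowerSeries ℤ_[p] ≃+* MvPowerSeries (Fin 1) ℤ_[p]) :=
  ⟨(MvPowerSeries.renameEquiv ℤ_[p] (finOneEquiv.symm : Unit ≃ Fin 1)).toRingEquiv⟩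

/-- The clause `IsAdicComplete (maximalIdeal R) R` for `R = ℤ_p⟦T⟧`: complete for `(p, T)` (the tree's
`powerSeries_isAdicComplete_maximalIdeal` over Mathlib's `IsAdicComplete (maximalIdeal ℤ_[p]) ℤ_[p]`).
[cite: Greenberg2016Selmer, §1 p. 4 L5–10] -/
theorem isAdicComplete_maximalIdeal_iwasawaAlgebra :
    IsAdicComplete (maximalIdeal (PowerSeries ℤ_[p])) (PowerSeries ℤ_[p]) :=
  Literature.NumberTheory.GaloisRepresentations.powerSeries_isAdicComplete_maximalIdeal

/-- The clause `Finite (ResidueField R)` for `R = ℤ_p⟦T⟧` (residue field `𝔽_p`).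
[cite: Greenberg2016Selmer, §1 p. 4 L5–10] -/
theorem finite_residueField_iwasawaAlgebra : Finite (ResidueField (PowerSeries ℤ_[p])) :=
  Finite.of_equiv _ ((residueFieldPowerSeriesEquiv (R := ℤ_[p])).trans
    (PadicInt.residueField (p := p))).symm.toEquiv

/-- The clause `CharP (ResidueField R) p` for `R = ℤ_p⟦T⟧`. [cite: Greenberg2016Selmer, §1 p. 4 L5–10] -/
theorem charP_residueField_iwasawaAlgebra : CharP (ResidueField (PowerSeries ℤ_[p])) p :=
  charP_of_injective_ringHom
    (f := ((residueFieldPowerSeriesEquiv (R := ℤ_[p])).trans (PadicInt.residueField (p := p))).symm.toRingHom)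
    ((residueFieldPowerSeriesEquiv (R := ℤ_[p])).trans (PadicInt.residueField (p := p))).symm.injective p

end Arena

/-! ## §2 The one-variable moment pairing `Λ ≅ Hom(𝐃₁, C)` and the structure of every balanced dual -/

section Duality

variable {p : ℕ} [Fact p.Prime] {A : Type} [AddCommGroup A] [Module ℤ_[p] A]
  {C : Type*} [AddCommGroup C] (jC : A →+ C)

/-- Every element of `𝐃₁ = Maps^∞(Γ, A)` is killed by a power of `p`, in the `ℤ`-form of the facts'
clause `∀ d, ∃ n, (p ^ n : ℤ) • d = 0`. [cite: SkinnerUrban2014, §3.1.3] -/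
theorem exists_zpow_smul_eq_zero (Φ : BigRepModule ℤ_[p] p A) : ∃ n : ℕ, (p ^ n : ℤ) • Φ = 0 := by
  obtain ⟨k, hk⟩ := exists_pow_smul_eq_zero Φ
  exact ⟨k, by rw [← Nat.cast_pow, natCast_zsmul, hk]⟩

/-- **The moment expansion of the `Λ`-action at the origin**: if `(τ₁ - 1)^N Φ = 0` then
`(F • Φ)(0) = ∑_{a<N} coeff_a(F) • ((τ₁ - 1)^a Φ)(0)`. [cite: Greenberg2010, §5 (PDF p. 26 L1–4) (sending x to γ − 1)] -/
theorem smul_apply_zero {N : ℕ} {Φ : BigRepModule ℤ_[p] p A}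
    (hN : (BigRepModule.shiftSubOne ^ N : BigRepModule ℤ_[p] p A →ₗ[ℤ_[p]] BigRepModule ℤ_[p] p A) Φ = 0)
    (F : PowerSeries ℤ_[p]) :
    (F • Φ) 0 = ∑ a ∈ range N, coeff a F •
      ((BigRepModule.shiftSubOne ^ a : BigRepModule ℤ_[p] p A →ₗ[ℤ_[p]] BigRepModule ℤ_[p] p A) Φ) 0 :=
  powerSeries_smul_apply_eq_sum hN F 0

/-- **The moment pairing on a Mahler element reads off one coefficient**:
`(F • binom i c)(0) = coeff_i(F) • c`. [folklore] -/
theorem smul_binom_apply_zero (hA : ∀ a : A, ∃ k : ℕ, p ^ k • a = 0) (F : PowerSeries ℤ_[p])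
    (i : ℕ) (c : A) : (F • binom (R := ℤ_[p]) hA i c) 0 = coeff i F • c := by
  have hN : (BigRepModule.shiftSubOne ^ (i + 1) :
      BigRepModule ℤ_[p] p A →ₗ[ℤ_[p]] BigRepModule ℤ_[p] p A) (binom (R := ℤ_[p]) hA i c) = 0 := by
    rw [shiftSubOne_pow_binom, if_neg (by omega)]
  rw [smul_apply_zero hN F]
  simp_rw [shiftSubOne_pow_binom_apply_zero, smul_ite, smul_zero]
  rw [Finset.sum_ite_eq' (range (i + 1)) i (fun a ↦ coeff a F • c), if_pos (mem_range.mpr (by omega))]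

/-- **The ONE-variable MOMENT PAIRING exists**: an additive `μ : Λ → Hom(𝐃₁, C)` with
`μ F Φ = j((F • Φ)(0))` — "`∫ Φ dF`" read through `j : A → C` —, the map identifying `Λ = ℤ_p[[Γ]]`
with the `C`-dual of the co-induced module (Iwasawa–Serre + Pontryagin; produced as `∃ μ`, no `def`).
[cite: Greenberg2006, p. 342 L5–11] -/
theorem exists_momentPairing :
    ∃ μ : PowerSeries ℤ_[p] →+ (BigRepModule ℤ_[p] p A →+ C),
      ∀ (F : PowerSeries ℤ_[p]) (Φ : BigRepModule ℤ_[p] p A), μ F Φ = jC ((F • Φ) 0) := by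
  refine ⟨AddMonoidHom.mk' (fun F ↦ jC.comp ((evalₗ ℤ_[p] (0 : ℤ_[p])).toAddMonoidHom.comp
    (DistribSMul.toAddMonoidHom (BigRepModule ℤ_[p] p A) F))) fun F G ↦ ?_, fun F Φ ↦ rfl⟩
  ext Φ
  simp only [AddMonoidHom.comp_apply, DistribSMul.toAddMonoidHom_apply, add_smul, map_add,
    AddMonoidHom.add_apply]

/-- **The moment pairing is injective** as soon as `ℤ_p → Hom(A, C)`, `c ↦ j ∘ (c • ·)` is: its value
on the `i`-th Mahler element is `j(coeff_i(F) • a)`. [cite: Greenberg2006, p. 342 L5–11] -/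
theorem momentPairing_injective (hA : ∀ a : A, ∃ k : ℕ, p ^ k • a = 0)
    (hinj : ∀ c : ℤ_[p], (∀ a : A, jC (c • a) = 0) → c = 0)
    {μ : PowerSeries ℤ_[p] →+ (BigRepModule ℤ_[p] p A →+ C)}
    (hμ : ∀ (F : PowerSeries ℤ_[p]) (Φ : BigRepModule ℤ_[p] p A), μ F Φ = jC ((F • Φ) 0)) :
    Function.Injective μ := by
  refine (injective_iff_map_eq_zero _).mpr fun F hF ↦ ?_
  refine PowerSeries.ext fun i ↦ ?_
  rw [map_zero]
  refine hinj _ fun a ↦ ?_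
  rw [← smul_binom_apply_zero hA F i a, ← hμ, hF, AddMonoidHom.zero_apply]

/-- **The moment pairing is surjective** as soon as every additive `A → C` is `j ∘ (c • ·)` for some
`c ∈ ℤ_p`: the preimage of `g ∈ Hom(𝐃₁, C)` is the series whose `i`-th coefficient represents
`g ∘ binom i`, by the finite Mahler expansion. [cite: Greenberg2006, p. 342 L5–11] -/
theorem momentPairing_surjective (hA : ∀ a : A, ∃ k : ℕ, p ^ k • a = 0)
    (hsurj : ∀ φ : A →+ C, ∃ c : ℤ_[p], ∀ a : A, φ a = jC (c • a))
    {μ : PowerSeries ℤ_[p] →+ (BigRepModule ℤ_[p] p A →+ C)}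
    (hμ : ∀ (F : PowerSeries ℤ_[p]) (Φ : BigRepModule ℤ_[p] p A), μ F Φ = jC ((F • Φ) 0)) :
    Function.Surjective μ := by
  intro g
  choose c hc using fun i : ℕ ↦ hsurj (g.comp (binom (R := ℤ_[p]) hA i))
  refine ⟨PowerSeries.mk c, ?_⟩
  ext Φ
  obtain ⟨N, hN⟩ := BigRepModule.shiftSubOne_locNil Φ
  rw [eq_sum_binom (R := ℤ_[p]) hA hN, map_sum, map_sum]
  refine sum_congr rfl fun i _ ↦ ?_
  rw [hμ, smul_binom_apply_zero, coeff_mk]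
  exact (hc i _).symm

/-- **Structure of the balanced duals of `𝐃₁` (Iwasawa–Serre + Pontryagin, corank one)**: if `A` is a
`p`-primary `ℤ_p`-module with `ℤ_p ≅ Hom(A, C)` through `j` (`c ↦ j ∘ (c • ·)` injective and onto),
then EVERY `Λ`-balanced `C`-dual `X ≅ Hom(𝐃₁, C)` of `𝐃₁ = A ⊗ Λ^*` (`Greenberg2016.IsDualPairing Λ 𝐃₁ toDual`)
is isomorphic to `Λ` as a `Λ`-module: the free cyclic module on the preimage `x₀` of the moment
functional `j ∘ eval₀` (`toDual (F • x₀) = μ F`). With `C = ℚ/ℤ` this is "`𝒟` is a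
cofree `Λ`-module" of rank one, with `C = K̄ˣ` it is "`T* ≅ Λ`". [cite: Greenberg2006, p. 342 L5–11]
[cite: Greenberg2016Selmer, §4.3 p. 20 L19–23] -/
theorem nonempty_linearEquiv_of_isDualPairing (hA : ∀ a : A, ∃ k : ℕ, p ^ k • a = 0)
    (hinj : ∀ c : ℤ_[p], (∀ a : A, jC (c • a) = 0) → c = 0)
    (hsurj : ∀ φ : A →+ C, ∃ c : ℤ_[p], ∀ a : A, φ a = jC (c • a))
    {X : Type} [AddCommGroup X] [Module (PowerSeries ℤ_[p]) X]
    {toDual : X →+ (BigRepModule ℤ_[p] p A →+ C)}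
    (hX : IsDualPairing (PowerSeries ℤ_[p]) (BigRepModule ℤ_[p] p A) toDual) :
    Nonempty (X ≃ₗ[PowerSeries ℤ_[p]] PowerSeries ℤ_[p]) := by
  obtain ⟨μ, hμ⟩ := exists_momentPairing (p := p) (A := A) jC
  obtain ⟨x₀, hx₀⟩ := hX.bijective.2 (μ 1)
  let ψ : PowerSeries ℤ_[p] →ₗ[PowerSeries ℤ_[p]] X := LinearMap.toSpanSingleton _ _ x₀
  have hψ : ∀ F, toDual (ψ F) = μ F := by
    intro F
    ext Φ
    rw [LinearMap.toSpanSingleton_apply, hX.map_smul, hx₀, hμ, hμ, one_smul]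
  have hbij : Function.Bijective ψ := by
    constructor
    · intro F G h
      apply momentPairing_injective jC hA hinj hμ
      rw [← hψ, ← hψ, h]
    · intro x
      obtain ⟨F, hF⟩ := momentPairing_surjective jC hA hsurj hμ (toDual x)
      exact ⟨F, hX.injective (by rw [hψ, hF])⟩
  exact ⟨(LinearEquiv.ofBijective ψ hbij).symm⟩

/-- **`𝐃₁ = A ⊗ Λ^*` IS A COFREE `Λ`-MODULE** (every Pontryagin dual is finite free), for `A`
`p`-primary of Pontryagin corank one (`ℤ_p ≅ Hom(A, ℚ/ℤ)` through `j`, e.g. `A ≅ ℚ_p/ℤ_p`): the clause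
`IsCofree R 𝐃` (`R = Λ = ℤ_p⟦T⟧`) of `Greenberg2016.prop263_sur_of_crk`.
[cite: Greenberg2006, p. 342 L5–11] [cite: Greenberg2016Selmer, §4.3 p. 20 L19–23] -/
theorem isCofree_bigRepModule (hA : ∀ a : A, ∃ k : ℕ, p ^ k • a = 0) (jQ : A →+ AddCircle (1 : ℚ))
    (hinj : ∀ c : ℤ_[p], (∀ a : A, jQ (c • a) = 0) → c = 0)
    (hsurj : ∀ φ : A →+ AddCircle (1 : ℚ), ∃ c : ℤ_[p], ∀ a : A, φ a = jQ (c • a)) :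
    IsCofree (PowerSeries ℤ_[p]) (BigRepModule ℤ_[p] p A) := by
  intro X _ _ toDual hX
  obtain ⟨e⟩ := nonempty_linearEquiv_of_isDualPairing jQ hA hinj hsurj hX
  exact ⟨Module.Free.of_equiv e.symm, Module.Finite.equiv e.symm⟩

/-- **`corank_Λ 𝐃₁ = 1`** — the `m = 1` input of Greenberg 2006 Props. 4.1 / 4.2 for the one-variable
twist deformation of a corank-one `A`. [cite: Greenberg2006, p. 342 L5–11] -/
theorem hasCorank_one_bigRepModule (hA : ∀ a : A, ∃ k : ℕ, p ^ k • a = 0) (jQ : A →+ AddCircle (1 : ℚ))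
    (hinj : ∀ c : ℤ_[p], (∀ a : A, jQ (c • a) = 0) → c = 0)
    (hsurj : ∀ φ : A →+ AddCircle (1 : ℚ), ∃ c : ℤ_[p], ∀ a : A, φ a = jQ (c • a)) :
    HasCorank (PowerSeries ℤ_[p]) (BigRepModule ℤ_[p] p A) 1 := by
  intro X _ _ toDual hX
  obtain ⟨e⟩ := nonempty_linearEquiv_of_isDualPairing jQ hA hinj hsurj hX
  rw [e.finrank_eq, Module.finrank_self]

/-- `𝐃₁` is cofinitely generated over `Λ` (the standing clause of Props. 4.1, 4.2, §5 A, 3.2).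
[cite: Greenberg2006, §4 p. 367 L33–39] -/
theorem isCofinitelyGenerated_bigRepModule (hA : ∀ a : A, ∃ k : ℕ, p ^ k • a = 0)
    (jQ : A →+ AddCircle (1 : ℚ)) (hinj : ∀ c : ℤ_[p], (∀ a : A, jQ (c • a) = 0) → c = 0)
    (hsurj : ∀ φ : A →+ AddCircle (1 : ℚ), ∃ c : ℤ_[p], ∀ a : A, φ a = jQ (c • a)) :
    IsCofinitelyGenerated (PowerSeries ℤ_[p]) (BigRepModule ℤ_[p] p A) :=
  IsCofree.isCofinitelyGenerated (isCofree_bigRepModule hA jQ hinj hsurj)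

/-- **RFX(`𝐃₁`)** ("Obviously, RFX(`𝒟`) is satisfied"). [cite: Greenberg2016Selmer, §4.3 p. 20 L23] -/
theorem rfx_bigRepModule (hA : ∀ a : A, ∃ k : ℕ, p ^ k • a = 0) (jQ : A →+ AddCircle (1 : ℚ))
    (hinj : ∀ c : ℤ_[p], (∀ a : A, jQ (c • a) = 0) → c = 0)
    (hsurj : ∀ φ : A →+ AddCircle (1 : ℚ), ∃ c : ℤ_[p], ∀ a : A, φ a = jQ (c • a)) :
    RFX (PowerSeries ℤ_[p]) (BigRepModule ℤ_[p] p A) :=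
  IsCofree.rfx (isCofree_bigRepModule hA jQ hinj hsurj)

/-! ## §3 `𝐃₁` is a divisible `Λ`-module -/

/-- **`𝐃₁ = A ⊗ Λ^*` IS `Λ`-DIVISIBLE** (`θ𝐃₁ = 𝐃₁` for every non-zero `θ ∈ Λ = ℤ_p⟦T⟧`) — the clause
"`𝐃` is divisible as a `Λ`-module" of Prop. 2.6.3 / [Greenberg2010] Prop. 3.2.1 (p. 3 L1–5: "`R̂` is a
divisible `Λ`-module. Consequently, `D` will be a divisible `Λ`-module"). Proof: a character of
`𝐃₁/θ𝐃₁` is a `θ`-torsion element of the Pontryagin dual `Hom(𝐃₁, ℚ/ℤ) ≃ₗ Λ`, a domain, hence `0`;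
`ℚ/ℤ` cogenerates (Mathlib `CharacterModule.exists_character_apply_ne_zero_of_ne_zero`).
[cite: Greenberg2010, §1 p. 3 L1–5; §2 p. 7 L4] [cite: Greenberg2016Selmer, §2.5 p. 8 L35–37] -/
theorem isDivisible_bigRepModule (hA : ∀ a : A, ∃ k : ℕ, p ^ k • a = 0) (jQ : A →+ AddCircle (1 : ℚ))
    (hinj : ∀ c : ℤ_[p], (∀ a : A, jQ (c • a) = 0) → c = 0)
    (hsurj : ∀ φ : A →+ AddCircle (1 : ℚ), ∃ c : ℤ_[p], ∀ a : A, φ a = jQ (c • a)) :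
    IsDivisible (PowerSeries ℤ_[p]) (BigRepModule ℤ_[p] p A) := by
  intro θ hθ Φ
  -- the Pontryagin dual `Hom(𝐃₁, ℚ/ℤ)` with its `Λ`-structure is `≃ₗ Λ`, torsion-free
  obtain ⟨e⟩ := nonempty_linearEquiv_of_isDualPairing jQ hA hinj hsurj
    (isDualPairing_characterModule (PowerSeries ℤ_[p]) (BigRepModule ℤ_[p] p A))
  by_contra hΦ
  -- `Φ ∉ θ𝐃₁`: a character of the quotient not vanishing on the class of `Φ`
  let N : Submodule (PowerSeries ℤ_[p]) (BigRepModule ℤ_[p] p A) :=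
    LinearMap.range (θ • (LinearMap.id : BigRepModule ℤ_[p] p A →ₗ[PowerSeries ℤ_[p]] BigRepModule ℤ_[p] p A))
  have hΦN : Submodule.Quotient.mk (p := N) Φ ≠ 0 := by
    intro h
    rw [Submodule.Quotient.mk_eq_zero, LinearMap.mem_range] at h
    obtain ⟨Ψ, hΨ⟩ := h
    exact hΦ ⟨Ψ, hΨ⟩
  obtain ⟨χ, hχ⟩ := CharacterModule.exists_character_apply_ne_zero_of_ne_zero hΦN
  -- pulled back to `𝐃₁` it is a non-zero `θ`-torsion character
  let c : CharacterModule (BigRepModule ℤ_[p] p A) := χ.comp N.mkQ.toAddMonoidHom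
  have hc : c ≠ 0 := fun h ↦ hχ (DFunLike.congr_fun h Φ)
  have hθc : θ • c = 0 := by
    ext Ψ
    change χ (N.mkQ (θ • Ψ)) = 0
    have hmem : θ • Ψ ∈ N := ⟨Ψ, rfl⟩
    rw [Submodule.mkQ_apply, (Submodule.Quotient.mk_eq_zero N).mpr hmem, map_zero]
  -- contradiction in the domain `Λ`
  have : θ • e c = 0 := by rw [← map_smul, hθc, map_zero]
  rcases smul_eq_zero.mp this with h | h
  · exact hθ h
  · exact hc (e.injective (by rw [h, map_zero]))

end Duality

end Summit.BirchSwinnertonDyer.BirchSwinnertonDyer.Theorems.AcTwistDeformation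

end
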